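import Literature.MathematicalPhysics.QuantumFieldTheory.Balaban1983to89.T4BetaFlowWellPosed

/-!
# EriceRemainderEnclosureHistoryAutonomyComparisonAgeCompositionMassCeiling — (E113c) route (N), first order: THE MASS ROUTE HAS A CEILING — ADMISSIBILITY
# DOES NOT BOUND THE TOTAL WINDOW LOAD BY ONE.  An EXPLICIT isotone memory functional with floor `1∕10` on the box `]0,10]^ℕ`, its box solution `h` from
# `g_IR = 10`, and a dominated two-age profile (ages `1` and `10⁷`, loads `32∕25` and `95`) whose total window load at the infrared pin is
# `Σ_k k·L_kh(k)³∕2 ≥ 1.08 > 1` (**`exists_admissible_total_load_gt_one`**); hence the hypothesis «`Σ_{k<K} k·L_kh(m+k)³∕2 ≤ 1` at every pin» of the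
# light-load END ((E86i) `flow_nonneg_of_light_total_mass`, (E89b) `flow_nonneg_of_window_loads_le_one`, and every theorem of the mass route (E90d),
# (E112a–e) that discharges it) is NOT a consequence of the standing admissibility hypotheses (isotone `B`, floor `b > 0`, domination `Σ L_ku_k ≤ B u` on
# the box, `SeqBox`, `MemFlow`, `L ≥ 0`): **`total_load_le_one_not_of_admissible`**.  THE WITNESS (README `HOME/b2b-balaban-beta-d4-p2/g94/README.md` §2):
# levels `a_t = 1∕h_t²` LINEAR with increment `1` for `40000` scales from `a_0 = 1∕100`, then LINEAR with increment `1∕10` (a two-slope concave flow);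
# `B u = max (32∕25·u_1 + 95·u_{10⁷}) (if h_{40000} ≤ u_0 then 1 else 1∕10)` (the dominated linear part never exceeds the step part along the flow — two
# inequalities, at the pin and at the kink, by monotonicity); the young age carries `0.63`, the old age `0.45`.  WHY `10⁷`: the supremum of the total load
# over admissible configurations tends to `(1+√2)∕2 ≈ 1.207` as the old age recedes (young age `→ √2∕2` on the pin's increment, old age `→ ½` on the
# late increments, sharing only the pin's budget), like `1.2 − O(K^{−1∕6})`; two-slope flows cross `1` at `K ≈ 1.5·10⁵`, the numerically worst shapes
# (young envelope `a ∼ t^{2∕3}` plus a thin layer) near `K ≈ 10⁴` (README §5, kit job); `10⁷` gives the margin `0.08` with round numbers.  CONSEQUENCE for the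
# census: README g93 §6 (1) «prove the two-increment family (F) for all concave level sequences» is IMPOSSIBLE beyond `K ≈ 10⁴`; the mass route is a
# finite-range route; its successor for wide profiles is the next-row certificate (E113a)∕(E113b), whose mass on this very witness is `0.80`.
# NOTE: the END itself HOLDS on the witness (`ε_0 = 0.32`, two ages at every ratio: (E91b) `flow_nonneg_two_ages_far`); only the ROUTE fails.  The excess
# over `1` lives at the infrared pin alone (`T(m) ≤ 0.68` from `m = 1` on): at interior pins the young age is capped by `a_m ≥ B_{m−1} ≥ B_m`.

Cell `pub-balaban`, β-function sub-cell, BINDER row D4 «RemainderConst leaves for Bałaban's split» (`HOME/BINDER-OWNERS.md`; owner lineage `b2b-balaban-beta-an4`;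
this file by co-owner #2 lineage `b2b-balaban-beta-d4-p2`, generation 94), β-FLOW TEAM duty (1), FREEZE (0) honoured (def-free: the witness is displayed by
defining HYPOTHESES on `a`, `h` in §2 and by explicit terms in §3; imports `T4BetaFlowWellPosed` only; nothing restated).

HONEST FRAMING (page 1, verbatim and binding).  *"Discharging BetaPertH makes Bałaban's UV stability UNCONDITIONAL — a real constructive-QFT result; it is
NOT the continuum limit and NOT the Clay problem."*  THIS FILE DISCHARGES NOTHING OF THE KIND.  Elementary real analysis about ABSTRACT functionals on a box
]0,γ]^ℕ — a NEGATIVE result about a SUFFICIENT CONDITION of the cell's own first-order census (route (N)); the form, signs, ages and moments of Bałaban's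
(1.22) limit functional are NOT PRINTED ([I] p. 298; GAPS G-t4-U2-1∕-2) and NOT asserted; whether Bałaban's functional is anywhere near the witness is not a
question this file can ask.  Row D4 class UNCHANGED (critical-path width 0; instance 0∕1; D4 DISCHARGE NO DATE).  HONEST DEPENDENCY: continuum YM on T⁴ ⇐
BetaPertH ∧ nine spine estimates (0/9 proved); BetaPertH ⇐ (D1) ∧ (D4) ∧ CAP+tail; G-an2-4 gates asym, D1 and NE2/3/4.

WHAT IS PROVED ([folklore]; 0 `def`, 0 sorry; `norm_num` on displayed rationals, no `decide`, no `native_decide`).  §1 `one_div_sqrt_le_of_sq_le`,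
`sqrt_le_of_le_sq`, `one_div_sqrt_pow_three`.  §2 (the two-slope flow, by hypotheses `ha`, `hh`): `lev_pos`, `lev_succ_sub`, `lev_strictMono`, `hist_facts`
(positivity, box, strict antitonicity), `young_old_reads_le` (the two budget inequalities along the whole flow), `total_load_witness_gt_one`.  §3
**`exists_admissible_total_load_gt_one`**, **`total_load_le_one_not_of_admissible`**.
-/
noncomputable section
open Finset

namespace Summit.QuantumFields.BalabanUV.Beta.EriceRemainderEnclosureHistoryAutonomyComparisonAgeCompositionMassCeiling

open Literature.MathematicalPhysics.QuantumFieldTheory.Balaban1983to89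
open Literature.MathematicalPhysics.QuantumFieldTheory.Balaban1983to89.T4BetaStationary
open Literature.MathematicalPhysics.QuantumFieldTheory.Balaban1983to89.T4BetaFlowWellPosed

/-! ## §1 Square-root bookkeeping -/

/-- `0 < r`, `r² ≤ x` ⟹ `1∕√x ≤ 1∕r`. [folklore] -/
theorem one_div_sqrt_le_of_sq_le {r x : ℝ} (hr : 0 < r) (hx : r ^ 2 ≤ x) : 1 / Real.sqrt x ≤ 1 / r :=
  one_div_le_one_div_of_le hr (by rw [← Real.sqrt_sq hr.le]; exact Real.sqrt_le_sqrt hx)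

/-- `0 ≤ u`, `x ≤ u²` ⟹ `√x ≤ u`. [folklore] -/
theorem sqrt_le_of_le_sq {u x : ℝ} (hu : 0 ≤ u) (hx : x ≤ u ^ 2) : Real.sqrt x ≤ u := by
  rw [← Real.sqrt_sq hu]; exact Real.sqrt_le_sqrt hx

/-- `0 < x` ⟹ `(1∕√x)³ = 1∕(x·√x)`. [folklore] -/
theorem one_div_sqrt_pow_three {x : ℝ} (hx : 0 < x) : (1 / Real.sqrt x) ^ 3 = 1 / (x * Real.sqrt x) := by
  have hs : Real.sqrt x ^ 2 = x := Real.sq_sqrt hx.le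
  rw [div_pow, one_pow, pow_succ, hs]

/-! ## §2 The two-slope flow and the two-age profile -/

variable {a h : ℕ → ℝ}

/-- The levels are positive (indeed `≥ 1∕100`). [folklore] -/
theorem lev_pos (ha : ∀ t : ℕ, a t = if t ≤ 40000 then (1 : ℝ) / 100 + (t : ℝ) else (1 : ℝ) / 100 + 40000 + ((t : ℝ) - 40000) / 10) (t : ℕ) :
    1 / 100 ≤ a t ∧ 0 < a t := by
  have h1 : 1 / 100 ≤ a t := by
    rw [ha]
    split_ifs with ht
    · have : (0 : ℝ) ≤ t := Nat.cast_nonneg t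
      linarith
    · have : (40000 : ℝ) ≤ t := by exact_mod_cast (show 40000 ≤ t by omega)
      linarith
  exact ⟨h1, by linarith⟩

/-- THE INCREMENTS: `a (t+1) − a t = 1` for `t < 40000` and `= 1∕10` for `t ≥ 40000`. [folklore] -/
theorem lev_succ_sub (ha : ∀ t : ℕ, a t = if t ≤ 40000 then (1 : ℝ) / 100 + (t : ℝ) else (1 : ℝ) / 100 + 40000 + ((t : ℝ) - 40000) / 10) (t : ℕ) :
    a (t + 1) - a t = if t < 40000 then 1 else 1 / 10 := by
  rw [ha (t + 1), ha t]
  by_cases ht : t < 40000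
  · rw [if_pos (show t + 1 ≤ 40000 by omega), if_pos (show t ≤ 40000 by omega), if_pos ht]; push_cast; ring
  · rw [if_neg (show ¬ t + 1 ≤ 40000 by omega), if_neg ht]
    by_cases ht' : t ≤ 40000
    · rw [if_pos ht']
      have : t = 40000 := by omega
      subst this; push_cast; ring
    · rw [if_neg ht']; push_cast; ring

/-- The levels increase strictly. [folklore] -/
theorem lev_strictMono (ha : ∀ t : ℕ, a t = if t ≤ 40000 then (1 : ℝ) / 100 + (t : ℝ) else (1 : ℝ) / 100 + 40000 + ((t : ℝ) - 40000) / 10) :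
    StrictMono a := by
  refine strictMono_nat_of_lt_succ fun t => ?_
  have := lev_succ_sub ha t
  split_ifs at this <;> linarith

/-- THE HISTORY `h = 1∕√a`: positive, in the box `]0,10]`, `h 0 = 10`, `1∕h² = a`, strictly antitone. [folklore] -/
theorem hist_facts (ha : ∀ t : ℕ, a t = if t ≤ 40000 then (1 : ℝ) / 100 + (t : ℝ) else (1 : ℝ) / 100 + 40000 + ((t : ℝ) - 40000) / 10)
    (hh : ∀ t, h t = 1 / Real.sqrt (a t)) :
    (∀ t, 0 < h t) ∧ (∀ t, h t ≤ 10) ∧ h 0 = 10 ∧ (∀ t, 1 / h t ^ 2 = a t) ∧ StrictAnti h := by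
  have hpos : ∀ t, 0 < h t := fun t => by rw [hh]; exact one_div_pos.2 (Real.sqrt_pos.2 (lev_pos ha t).2)
  refine ⟨hpos, fun t => ?_, ?_, fun t => ?_, ?_⟩
  · rw [hh]
    calc 1 / Real.sqrt (a t) ≤ 1 / (1 / 10) := one_div_sqrt_le_of_sq_le (by norm_num) (by norm_num [(lev_pos ha t).1])
      _ = 10 := by norm_num
  · rw [hh, ha, if_pos (Nat.zero_le _)]
    rw [show (1 : ℝ) / 100 + ((0 : ℕ) : ℝ) = (1 / 10) ^ 2 by norm_num, Real.sqrt_sq (by norm_num)]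
    norm_num
  · rw [hh, div_pow, one_pow, Real.sq_sqrt (lev_pos ha t).2.le, one_div_one_div]
  · intro s t hst
    rw [hh, hh]
    exact one_div_lt_one_div_of_lt (Real.sqrt_pos.2 (lev_pos ha s).2)
      (Real.sqrt_lt_sqrt (lev_pos ha s).2.le (lev_strictMono ha hst))

/-- **THE TWO BUDGET INEQUALITIES ALONG THE WHOLE FLOW.**  The young read `32∕25·h(m+2)` plus the old read `95·h(m+1+10⁷)` is `≤ 1` at every scale and
`≤ 1∕10` from the kink `m ≥ 40000` on: by antitonicity it suffices to look at `m = 0` (`√2.01 ≥ 1.417`, `√1036000.11 ≥ 1017`) and at `m = 40000`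
(`√40000.21 ≥ 200`, `√1040000.11 ≥ 1019`). [folklore] -/
theorem young_old_reads_le (ha : ∀ t : ℕ, a t = if t ≤ 40000 then (1 : ℝ) / 100 + (t : ℝ) else (1 : ℝ) / 100 + 40000 + ((t : ℝ) - 40000) / 10)
    (hh : ∀ t, h t = 1 / Real.sqrt (a t)) (m : ℕ) :
    32 / 25 * h (m + 2) + 95 * h (m + 1 + 10000000) ≤ 1 ∧
      (40000 ≤ m → 32 / 25 * h (m + 2) + 95 * h (m + 1 + 10000000) ≤ 1 / 10) := by
  obtain ⟨hpos, -, -, -, hanti⟩ := hist_facts ha hh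
  have hmono : ∀ s t, s ≤ t → h t ≤ h s := fun s t hst => hanti.antitone hst
  have h2 : h 2 ≤ 1000 / 1417 := by
    rw [hh, ha, if_pos (by norm_num), show (1000 : ℝ) / 1417 = 1 / (1417 / 1000) by norm_num]
    exact one_div_sqrt_le_of_sq_le (by norm_num) (by push_cast; norm_num)
  have hK1 : h 10000001 ≤ 1 / 1017 := by
    rw [hh, ha, if_neg (by norm_num)]
    exact one_div_sqrt_le_of_sq_le (by norm_num) (by push_cast; norm_num)
  have hP2 : h 40002 ≤ 1 / 200 := by
    rw [hh, ha, if_neg (by norm_num)]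
    exact one_div_sqrt_le_of_sq_le (by norm_num) (by push_cast; norm_num)
  have hKP : h 10040001 ≤ 1 / 1019 := by
    rw [hh, ha, if_neg (by norm_num)]
    exact one_div_sqrt_le_of_sq_le (by norm_num) (by push_cast; norm_num)
  constructor
  · have e1 := hmono 2 (m + 2) (by omega)
    have e2 := hmono 10000001 (m + 1 + 10000000) (by omega)
    nlinarith
  · intro hm
    have e1 := hmono 40002 (m + 2) (by omega)
    have e2 := hmono 10040001 (m + 1 + 10000000) (by omega)
    nlinarith

/-- **THE TOTAL WINDOW LOAD AT THE INFRARED PIN EXCEEDS ONE**: `32∕25·h(1)³∕2 + 10⁷·95·h(10⁷)³∕2 ≥ 0.6305 + 0.4503 > 1` (`√1.01 ≤ 1.005`,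
`√1036000.01 ≤ 1018`). [folklore] -/
theorem total_load_witness_gt_one (ha : ∀ t : ℕ, a t = if t ≤ 40000 then (1 : ℝ) / 100 + (t : ℝ) else (1 : ℝ) / 100 + 40000 + ((t : ℝ) - 40000) / 10)
    (hh : ∀ t, h t = 1 / Real.sqrt (a t)) :
    1 < (1 : ℝ) * (32 / 25 * h 1 ^ 3 / 2) + (10000000 : ℝ) * (95 * h 10000000 ^ 3 / 2) := by
  have ha1 : a 1 = 101 / 100 := by rw [ha, if_pos (by norm_num)]; push_cast; norm_num
  have haK : a 10000000 = 103600001 / 100 := by rw [ha, if_neg (by norm_num)]; push_cast; norm_num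
  have h1 : 1 / (101 / 100 * (201 / 200)) ≤ h 1 ^ 3 := by
    rw [hh, one_div_sqrt_pow_three (lev_pos ha 1).2, ha1]
    exact one_div_le_one_div_of_le (by positivity)
      (mul_le_mul_of_nonneg_left (sqrt_le_of_le_sq (by norm_num) (by norm_num)) (by norm_num))
  have hK : 1 / (103600001 / 100 * 1018) ≤ h 10000000 ^ 3 := by
    rw [hh, one_div_sqrt_pow_three (lev_pos ha 10000000).2, haK]
    exact one_div_le_one_div_of_le (by positivity)
      (mul_le_mul_of_nonneg_left (sqrt_le_of_le_sq (by norm_num) (by norm_num)) (by norm_num))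
  nlinarith

/-! ## §3 The witness assembled -/

/-- **ADMISSIBILITY DOES NOT BOUND THE TOTAL WINDOW LOAD BY ONE.**  There are an isotone functional `B` on the box `]0,γ]^ℕ` with floor `b > 0`, a box
history `h` solving the flow with memory `MemFlow B gIR h`, and a non-negative profile `L` on the ages `< K` dominated by `B` (`Σ_{k<K} L_ku_k ≤ B u` on the
box) whose total window load at the infrared pin exceeds one: `1 < Σ_{k<K} k·L_kh(0+k)³∕2`.  Witness: the two-slope flow of §2 (`γ = gIR = 10`, `b = 1∕10`),
`K = 10⁷ + 1`, `L = 32∕25·δ_1 + 95·δ_{10⁷}`, `B u = max (32∕25·u 1 + 95·u 10⁷) (if h 40000 ≤ u 0 then 1 else 1∕10)`. [folklore] -/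
theorem exists_admissible_total_load_gt_one :
    ∃ (B : (ℕ → ℝ) → ℝ) (γ b gIR : ℝ) (h L : ℕ → ℝ) (K : ℕ),
      (∀ u v : ℕ → ℝ, SeqBox γ u → SeqBox γ v → (∀ j, u j ≤ v j) → B u ≤ B v) ∧ 0 < b ∧ (∀ u, SeqBox γ u → b ≤ B u) ∧
      (∀ u, SeqBox γ u → ∑ k ∈ range K, L k * u k ≤ B u) ∧ SeqBox γ h ∧ MemFlow B gIR h ∧ (∀ k, 0 ≤ L k) ∧
      1 < ∑ k ∈ range K, (k : ℝ) * (L k * h (0 + k) ^ 3 / 2) := by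
  -- the levels and the history
  obtain ⟨a, ha⟩ : ∃ a : ℕ → ℝ, ∀ t : ℕ, a t = if t ≤ 40000 then (1 : ℝ) / 100 + (t : ℝ) else (1 : ℝ) / 100 + 40000 + ((t : ℝ) - 40000) / 10 :=
    ⟨fun t => if t ≤ 40000 then (1 : ℝ) / 100 + (t : ℝ) else (1 : ℝ) / 100 + 40000 + ((t : ℝ) - 40000) / 10, fun t => rfl⟩
  obtain ⟨h, hh⟩ : ∃ h : ℕ → ℝ, ∀ t, h t = 1 / Real.sqrt (a t) := ⟨fun t => 1 / Real.sqrt (a t), fun t => rfl⟩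
  obtain ⟨hpos, hbox, h0, hsq, hanti⟩ := hist_facts ha hh
  -- the profile and its reads
  obtain ⟨L, hL⟩ : ∃ L : ℕ → ℝ, ∀ k, L k = (if k = 1 then 32 / 25 else 0) + (if k = 10000000 then 95 else 0) :=
    ⟨fun k => (if k = 1 then 32 / 25 else 0) + (if k = 10000000 then 95 else 0), fun k => rfl⟩
  have hLsum : ∀ u : ℕ → ℝ, ∑ k ∈ range 10000001, L k * u k = 32 / 25 * u 1 + 95 * u 10000000 := by
    intro u
    simp_rw [hL, add_mul, sum_add_distrib, ite_mul, zero_mul]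
    rw [sum_ite_eq' (range 10000001) 1 (fun k => 32 / 25 * u k), sum_ite_eq' (range 10000001) 10000000 (fun k => 95 * u k),
      if_pos (mem_range.mpr (by norm_num)), if_pos (mem_range.mpr (by norm_num))]
  refine ⟨fun u => max (32 / 25 * u 1 + 95 * u 10000000) (if h 40000 ≤ u 0 then 1 else 1 / 10), 10, 1 / 10, 10, h, L, 10000001,
    ?_, by norm_num, ?_, ?_, fun j => ⟨hpos j, hbox j⟩, ?_, ?_, ?_⟩
  · -- isotone
    intro u v _ _ huv
    refine max_le_max (by linarith [huv 1, huv 10000000]) ?_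
    by_cases hu0 : h 40000 ≤ u 0
    · rw [if_pos hu0, if_pos (hu0.trans (huv 0))]
    · rw [if_neg hu0]; split_ifs <;> norm_num
  · -- floor
    intro u _
    refine le_max_of_le_right ?_
    split_ifs <;> norm_num
  · -- domination
    intro u _
    rw [hLsum u]
    exact le_max_left _ _
  · -- the flow with memory
    refine ⟨h0, fun m => ?_⟩
    rw [hsq, hsq]
    obtain ⟨hle1, hle10⟩ := young_old_reads_le ha hh m
    have hstep := lev_succ_sub ha m
    simp only [add_zero, show m + 1 + 1 = m + 2 by ring]
    by_cases hm : m < 40000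
    · rw [if_pos hm] at hstep
      have hm0 : h 40000 ≤ h (m + 1) := hanti.antitone (by omega)
      rw [if_pos hm0, max_eq_right hle1]
      linarith
    · rw [if_neg hm] at hstep
      have hm0 : ¬ h 40000 ≤ h (m + 1) := not_le.mpr (hanti (by omega))
      rw [if_neg hm0, max_eq_right (hle10 (by omega))]
      linarith
  · -- non-negative loads
    intro k; rw [hL]; split_ifs <;> norm_num
  · -- the total window load at the infrared pin
    have hT : ∑ k ∈ range 10000001, (k : ℝ) * (L k * h (0 + k) ^ 3 / 2)
        = (1 : ℝ) * (32 / 25 * h 1 ^ 3 / 2) + (10000000 : ℝ) * (95 * h 10000000 ^ 3 / 2) :=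
      calc ∑ k ∈ range 10000001, (k : ℝ) * (L k * h (0 + k) ^ 3 / 2)
          = ∑ k ∈ range 10000001, L k * ((k : ℝ) * h k ^ 3 / 2) := sum_congr rfl fun k _ => by rw [zero_add]; ring
        _ = 32 / 25 * (((1 : ℕ) : ℝ) * h 1 ^ 3 / 2) + 95 * (((10000000 : ℕ) : ℝ) * h 10000000 ^ 3 / 2) :=
          hLsum (fun k => (k : ℝ) * h k ^ 3 / 2)
        _ = (1 : ℝ) * (32 / 25 * h 1 ^ 3 / 2) + (10000000 : ℝ) * (95 * h 10000000 ^ 3 / 2) := by push_cast; ring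
    rw [hT]
    exact total_load_witness_gt_one ha hh

/-- **COROLLARY.**  The implication «admissible ⟹ total window load `≤ 1` at every pin» — the hypothesis `hlight` of (E86i)∕(E89b) read as a consequence
of the standing hypotheses — is FALSE. [folklore] -/
theorem total_load_le_one_not_of_admissible :
    ¬ (∀ (B : (ℕ → ℝ) → ℝ) (γ b gIR : ℝ) (h L : ℕ → ℝ) (K : ℕ),
      (∀ u v : ℕ → ℝ, SeqBox γ u → SeqBox γ v → (∀ j, u j ≤ v j) → B u ≤ B v) → 0 < b → (∀ u, SeqBox γ u → b ≤ B u) →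
      (∀ u, SeqBox γ u → ∑ k ∈ range K, L k * u k ≤ B u) → SeqBox γ h → MemFlow B gIR h → (∀ k, 0 ≤ L k) →
      ∀ m, ∑ k ∈ range K, (k : ℝ) * (L k * h (m + k) ^ 3 / 2) ≤ 1) := by
  intro H
  obtain ⟨B, γ, b, gIR, h, L, K, hmono, hb, hlo, hdom, hh, hf, hL, hgt⟩ := exists_admissible_total_load_gt_one
  exact absurd (H B γ b gIR h L K hmono hb hlo hdom hh hf hL 0) (not_le.mpr hgt)

end Summit.QuantumFields.BalabanUV.Beta.EriceRemainderEnclosureHistoryAutonomyComparisonAgeCompositionMassCeiling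

end
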